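import Summits.QuantumFields.GaugeBoot.ZdLoopClasses
import Summits.QuantumFields.GaugeBoot.ZdLoopEquationSU2
import Summits.QuantumFields.GaugeBoot.MMRowSU2
import HarnessLib

/-!
# Rows as data for Class-B states: the `SU(2)` loop-equation row of a marked word vanishes on every Haar-shift, `ℤ³ ⋊ B₃`-invariant state (gauge-boot, Class-B rows 3/3)

HONEST FRAMING (cell `pub-gaugeboot`, page 1 of every file): the venture produces certified bounds
on lattice expectations at stated coupling, gauge group, dimension and torus size; NOT a mass gap,
NOT a continuum limit, NOT a string tension; NOT Yang–Mills-summit-bearing (barriers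
`FixedCouplingUltralocality`, `PerturbativeInvisibility`).

`MMRowSU2.lean` (lean2's rows-as-data engine) computes eng1's `mm_row` for `SU(2)`, `D = 3` in Lean
(`mmRowSU2 X cs : ERow`) and proves ONE soundness theorem `rowSum β L (mmRowSU2 X cs) = 0` on every
torus `(ℤ/L)³`, `L ≥ B + 2`; the data modules (`KZL2D3SDRows*`, `GLYZc2D3SDRows`, …) then carry hundreds
of generator rows as `(marked word, witness codes)` lists checked by `decide`. This file is the SAME
soundness theorem for the other statement class of the cell: the value of a row on a state `μ` of the
INFINITE lattice `ℤ³`,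

  `rowSumZd μ β r = Σ_{(w, c0, c1) ∈ r} (c0 + c1·β/8) · ∫ W_0(w) dμ`   (`W = ½ Re tr`, `β` standard),

vanishes for `r = mmRowSU2 X cs` (every closed marked word `X`, EVERY witness list `cs`, NO displacement
bound — `ℤ³` has no wrap-around) as soon as `μ` is a finite measure with the one-link Haar-shift identity
at tree coupling `β/2` (`IsHaarShiftState`, giving the loop equation: `ZdLoopEquationSU2.lean`) that is
invariant under translations, axis permutations and axis reflections (giving the relabelling by
canonical class labels: `ZdLoopClasses.lean`) — in particular for every **Class-B state**
(`ClassBState.rowSumZd_mmRowSU2`, `ClassBState.rowSumZd_of_SDCheck`). So every single-link row of the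
existing data modules is, verbatim, a valid `H`-side row of a Class-B certificate. (The `SU(2)` trace
rows `traceRowSU2` need the positioned-pair calculus of `PairLoopClasses.lean` on `ℤ³`; not here.)

Everything is `[folklore]`.
-/

noncomputable section

open MeasureTheory
open scoped Matrix
open Literature.Probability.LatticeModels (Site)
open Literature.MathematicalPhysics.QuantumLattice (LGConfig ZdEdge IsZdTranslationInvariant)

namespace Summit.QuantumFields.GaugeBoot

/-! ## The value of a row on a state of `ℤ³` -/

/-- The `SU(2)` loop variable of a measure `μ` on `ℤ³` configurations: `WZd μ w = ∫ W_0(w) dμ`,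
`W = ½ Re tr`. [folklore] -/
def WZd (μ : Measure (LGConfig 3 (SU 2))) (w : Word 3) : ℝ := ∫ U, wordLoopZd (suRep 2) (0 : Site 3) w U ∂μ

/-- The value of a row (`ERow`: terms `(label, c0, c1)`, coefficient `c0 + c1·β/8`, `β` standard) on the
state `μ`: `Σ (c0 + c1·β/8)·WZd μ label` — the `ℤ³` twin of `rowSum β L`. [folklore] -/
def rowSumZd (μ : Measure (LGConfig 3 (SU 2))) (β : ℝ) (r : ERow) : ℝ :=
  (r.map fun t => (((t.2.1 : ℚ) : ℝ) + ((t.2.2 : ℚ) : ℝ) * (β / 8)) * WZd μ t.1).sum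

variable (μ : Measure (LGConfig 3 (SU 2))) (β : ℝ)

/-- Unfolding lemma `rowSumZd_nil`. [folklore] -/
@[simp] theorem rowSumZd_nil : rowSumZd μ β [] = 0 := rfl

/-- Unfolding lemma `rowSumZd_cons`. [folklore] -/
@[simp] theorem rowSumZd_cons (t : Word 3 × ℚ × ℚ) (r : ERow) :
    rowSumZd μ β (t :: r) = (((t.2.1 : ℚ) : ℝ) + ((t.2.2 : ℚ) : ℝ) * (β / 8)) * WZd μ t.1 + rowSumZd μ β r := by
  simp [rowSumZd]

/-- `rowSumZd` is additive under concatenation. [folklore] -/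
@[simp] theorem rowSumZd_append (r r' : ERow) : rowSumZd μ β (r ++ r') = rowSumZd μ β r + rowSumZd μ β r' := by
  simp [rowSumZd, List.sum_append]

/-- `addTerm` adds the value of the term. [folklore] -/
theorem rowSumZd_addTerm (r : ERow) (t : Word 3 × ℚ × ℚ) :
    rowSumZd μ β (r.addTerm t) = rowSumZd μ β r + rowSumZd μ β [t] := by
  induction r with
  | nil => simp [ERow.addTerm]
  | cons u r ih =>
    simp only [ERow.addTerm]
    split_ifs with h
    · simp only [rowSumZd_cons, rowSumZd_nil, h]
      push_cast
      ring
    · simp only [rowSumZd_cons, ih, rowSumZd_nil]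
      ring

/-- Merging preserves the value. [folklore] -/
theorem rowSumZd_merge (r : ERow) : rowSumZd μ β r.merge = rowSumZd μ β r := by
  suffices h : ∀ (acc : ERow), rowSumZd μ β (r.foldl ERow.addTerm acc) = rowSumZd μ β acc + rowSumZd μ β r by
    simpa [ERow.merge] using h []
  induction r with
  | nil => intro acc; simp
  | cons t r ih =>
    intro acc
    simp only [List.foldl_cons, ih, rowSumZd_addTerm, rowSumZd_cons, rowSumZd_nil]
    ring

/-- Cleaning preserves the value. [folklore] -/
theorem rowSumZd_clean (r : ERow) : rowSumZd μ β r.clean = rowSumZd μ β r := by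
  induction r with
  | nil => simp [ERow.clean]
  | cons t r ih =>
    simp only [ERow.clean, List.filter_cons] at ih ⊢
    split_ifs with h
    · simp only [rowSumZd_cons, ih]
    · simp only [decide_eq_true_eq, not_or, not_not] at h
      simp only [rowSumZd_cons, ih, h.1, h.2]
      push_cast
      ring

/-- `rowSumZd` of a `flatMap` over `range n` is a `Finset.range` sum. [folklore] -/
theorem rowSumZd_flatMap_range (f : ℕ → ERow) :
    ∀ n : ℕ, rowSumZd μ β ((List.range n).flatMap f) = ∑ k ∈ Finset.range n, rowSumZd μ β (f k)
  | 0 => by simp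
  | n + 1 => by
    rw [List.range_succ, List.flatMap_append, rowSumZd_append, rowSumZd_flatMap_range f n, Finset.sum_range_succ]
    simp

/-! ## Relabelling by witness codes: translation- and `B₃`-invariant states -/

section Relabel

variable {μ}
variable (hT : IsZdTranslationInvariant μ) (hP : ∀ σ : Equiv.Perm (Fin 3), MeasurePreserving (configPerm σ) μ μ)
  (hR : ∀ i : Fin 3, MeasurePreserving (configSiteReflect i) μ μ)
include hT hP hR

/-- **Relabelling by ANY witness code preserves the loop variable** of an invariant state:
`WZd μ (w.canonW c) = WZd μ w` for closed `w`. [folklore] -/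
theorem WZd_canonW (c : ℕ) (w : Word 3) (hw : Word.disp w = 0) : WZd μ (w.canonW c) = WZd μ w := by
  unfold WZd
  exact integral_wordLoopZd_canonW (suRep 2) (continuous_suRep 2) hT hP hR c w hw

/-- Relabelling one term preserves the value. [folklore] -/
theorem rowSumZd_relabelTerm (c : ℕ) (t : Word 3 × ℚ × ℚ) :
    rowSumZd μ β [ERow.relabelTerm c t] = rowSumZd μ β [t] := by
  unfold ERow.relabelTerm
  split_ifs with h
  · simp only [rowSumZd_cons, rowSumZd_nil, WZd_canonW hT hP hR c t.1 h]
  · rfl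

/-- Relabelling preserves the value, for EVERY code list. [folklore] -/
theorem rowSumZd_relabel : ∀ (cs : List ℕ) (r : ERow), rowSumZd μ β (ERow.relabel cs r) = rowSumZd μ β r
  | _, [] => by simp [ERow.relabel]
  | [], t :: r => by
    have ht := rowSumZd_relabelTerm β hT hP hR 0 t
    simp only [rowSumZd_cons, rowSumZd_nil, add_zero] at ht
    rw [ERow.relabel, rowSumZd_cons, rowSumZd_cons, rowSumZd_relabel [] r, ht]
  | c :: cs, t :: r => by
    have ht := rowSumZd_relabelTerm β hT hP hR c t
    simp only [rowSumZd_cons, rowSumZd_nil, add_zero] at ht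
    rw [ERow.relabel, rowSumZd_cons, rowSumZd_cons, rowSumZd_relabel cs r, ht]

end Relabel

/-! ## The raw row vanishes: Haar-shift states -/

section Raw

variable {μ} [IsFiniteMeasure μ]

/-- **The raw terms sum to zero** on a Haar-shift state at tree coupling `β/2`: `¼ ×`
`IsHaarShiftState.loopEquation_su_two_loops` at the link `(0, +e₀)`, for every CLOSED marked word (no
displacement bound on `ℤ³`). [folklore] -/
theorem rowSumZd_sdTermsRaw (hμ : IsHaarShiftState (suRep 2) (β / 2) μ) (X : Word 3) (hX : Word.disp X = 0) :
    rowSumZd μ β (sdTermsRaw X) = 0 := by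
  have h := hμ.loopEquation_su_two_loops μ (0 : Site 3) 0 X (endpointZd_eq_self_of_disp 0 hX)
  have hW : ∀ v : Word 3, ∫ U, wordLoopZd (suRep 2) (0 : Site 3) v U ∂μ = WZd μ v := fun v => rfl
  simp only [hW, univ_erase_zero_fin_three] at h
  rw [Finset.sum_pair (show (1 : Fin 3) ≠ 2 by decide), Finset.sum_filter, Finset.sum_filter,
    ← Finset.sum_sub_distrib] at h
  simp only [Fintype.sum_bool] at h
  have hat : ∀ k, rowSumZd μ β (sdTermsAt X k) = (1 / 4 : ℝ) *
      ((if X.fwdOccZ 0 k then WZd μ X + 2 * WZd μ (X.take k ++ Word.reverse (X.drop k)) else 0) -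
        (if X.bwdOccZ 0 k then WZd μ X + 2 * WZd μ (X.take (k + 1) ++ Word.reverse (X.drop (k + 1)))
          else 0)) := by
    intro k
    unfold sdTermsAt
    split_ifs <;> simp only [rowSumZd_append, rowSumZd_cons, rowSumZd_nil, List.nil_append, List.append_nil] <;>
      push_cast <;> ring
  rw [sdTermsRaw, rowSumZd_append, rowSumZd_append, rowSumZd_flatMap_range]
  simp only [hat]
  rw [← Finset.mul_sum]
  simp only [sdPlaqTerms, rowSumZd_cons, rowSumZd_nil]
  push_cast at h ⊢
  linear_combination (1 / 4 : ℝ) * h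

/-- **Soundness of the computed row on a state of `ℤ³`**: `rowSumZd μ β (mmRowSU2 X cs) = 0` for every
closed marked word `X`, every witness list `cs`, every finite measure `μ` with the Haar-shift identity at
tree coupling `β/2` that is invariant under translations, axis permutations and axis reflections.
[folklore] -/
theorem rowSumZd_mmRowSU2 (hμ : IsHaarShiftState (suRep 2) (β / 2) μ) (hT : IsZdTranslationInvariant μ)
    (hP : ∀ σ : Equiv.Perm (Fin 3), MeasurePreserving (configPerm σ) μ μ)
    (hR : ∀ i : Fin 3, MeasurePreserving (configSiteReflect i) μ μ) (X : Word 3) (cs : List ℕ)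
    (hX : Word.disp X = 0) : rowSumZd μ β (mmRowSU2 X cs) = 0 := by
  rw [mmRowSU2, rowSumZd_clean, rowSumZd_merge, rowSumZd_relabel β hT hP hR, rowSumZd_sdTermsRaw β hμ X hX]

/-- **All rows of a checked SD family vanish** on such a state (the family's `SDCheck B` — closedness and
a displacement bound, the latter unused on `ℤ³` — is exactly what the data modules prove by `decide`).
[folklore] -/
theorem rowSumZd_of_SDCheck (hμ : IsHaarShiftState (suRep 2) (β / 2) μ) (hT : IsZdTranslationInvariant μ)
    (hP : ∀ σ : Equiv.Perm (Fin 3), MeasurePreserving (configPerm σ) μ μ)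
    (hR : ∀ i : Fin 3, MeasurePreserving (configSiteReflect i) μ μ) {B : ℕ}
    {rs : List (Word 3 × List ℕ)} (h : SDCheck B rs = true) :
    ∀ r ∈ rs, rowSumZd μ β (mmRowSU2 r.1 r.2) = 0 := by
  intro r hr
  have h' := List.all_eq_true.1 h r hr
  simp only [Bool.and_eq_true, decide_eq_true_eq] at h'
  exact rowSumZd_mmRowSU2 β hμ hT hP hR r.1 r.2 h'.1

end Raw

/-! ## Class-B states -/

section ClassB

/-- **Every `mm_row` vanishes on every Class-B state** (`SU(2)`, `ℤ³`, tree coupling `β/2`, i.e. standard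
coupling `β`): `rowSumZd ω.μ β (mmRowSU2 X cs) = 0` for every closed marked word and every witness list.
[folklore] -/
theorem ClassBState.rowSumZd_mmRowSU2 {β : ℝ} (ω : ClassBState 3 (suRep 2) (β / 2)) (X : Word 3) (cs : List ℕ)
    (hX : Word.disp X = 0) : rowSumZd ω.μ β (mmRowSU2 X cs) = 0 := by
  haveI := ω.isProbabilityMeasure
  exact _root_.Summit.QuantumFields.GaugeBoot.rowSumZd_mmRowSU2 β ω.haarShift ω.translationInvariant
    ω.permInvariant ω.reflectInvariant X cs hX

/-- **All rows of a checked SD family vanish on every Class-B state** — so the single-link rows of the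
data modules (`KZL2D3SDRows*`, `GLYZc2D3SDRows`, …, checked by `SDCheck`) are `H`-side rows of every
Class-B certificate, verbatim. [folklore] -/
theorem ClassBState.rowSumZd_of_SDCheck {β : ℝ} (ω : ClassBState 3 (suRep 2) (β / 2)) {B : ℕ}
    {rs : List (Word 3 × List ℕ)} (h : SDCheck B rs = true) :
    ∀ r ∈ rs, rowSumZd ω.μ β (mmRowSU2 r.1 r.2) = 0 := by
  haveI := ω.isProbabilityMeasure
  exact _root_.Summit.QuantumFields.GaugeBoot.rowSumZd_of_SDCheck β ω.haarShift ω.translationInvariant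
    ω.permInvariant ω.reflectInvariant h

/-- `WZd` of the empty word on a Class-B state is `1` (normalisation of the variables). [folklore] -/
theorem ClassBState.WZd_nil {β : ℝ} (ω : ClassBState 3 (suRep 2) β) : WZd ω.μ [] = 1 := by
  haveI := ω.isProbabilityMeasure
  have h : wordLoopZd (suRep 2) (0 : Site 3) ([] : Word 3) = fun _ : LGConfig 3 (SU 2) => (1 : ℝ) := by
    funext U
    rw [wordLoopZd_apply, wordHolonomyZd_nil, map_one, Matrix.trace_one, Fintype.card_fin]
    norm_num
  unfold WZd
  rw [h]
  simp

/-- `|WZd ω.μ w| ≤ 1` on a Class-B state (the a-priori bound of the variables). [folklore] -/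
theorem ClassBState.abs_WZd_le_one {β : ℝ} (ω : ClassBState 3 (suRep 2) β) (w : Word 3) : |WZd ω.μ w| ≤ 1 := by
  haveI := ω.isProbabilityMeasure
  exact abs_integral_wordLoopZd_le_one (suRep 2) (continuous_suRep 2) ω.μ 0 w

/-- Example (closed computation + the soundness theorem): eng1 G1 row 0 — the plaquette equation, marked
word `+0 +1 −0 −1` with its witness codes — holds for EVERY Class-B state of `SU(2)` on `ℤ³` at every
coupling. [folklore] -/
example {β : ℝ} (ω : ClassBState 3 (suRep 2) (β / 2)) :
    rowSumZd ω.μ β (mmRowSU2 [.fwd 0, .fwd 1, .bwd 0, .bwd 1] [0, 64, 0, 0, 28680, 8392, 0, 12488, 4, 12492]) = 0 :=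
  ω.rowSumZd_mmRowSU2 _ _ (by decide)

end ClassB

end Summit.QuantumFields.GaugeBoot

end
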